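import Summits.ResolutionOfSingularities.ResolutionOfSingularities.Theorems.ValuativeLuAlphaPTorsorCornerStep

/-!
# Giraud's corner step, re-packaged as the induction state at the quadratic transform

Helper file for the stub `giraud_corner_step_state` (CS-conv: the CORNER STEP of Giraud's
induction, Giraud 1983 Lemme 2.3(i), with its output re-packaged as the induction state at `R₁`)
of the line `pfaff-line-log-final-forms` (crux `Valuative.LuAlphaPTorsor`, item
`stmt-ResolutionOfSingularities-0641`).

Setting: `R ⊆ K` a two-dimensional regular local ring dominated by the valuation ring `O`, rich
in `ℤ`-derivations, `R₁` its quadratic transform along `O`, `u = (u 0, u 1)` a regular system of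
parameters (a CORNER: full boundary), and the log-content ideal of `f` of the shape
`C(f) = (u 0 ^ N 0 · u 1 ^ N 1) · J₀` with `J₀ ≠ R` of finite colength. Let `x = u i₀` be the
parameter of minimal value, `y` the other one, `t = y / x`; then `R₁ = A_Q`, `A = R[t]`,
`Q = 𝔪_O ∩ A` (`eq_locAtCentre_blowupRing_cornerStep`), and in the chart coordinates
`u' = (x, t)` the log-content of `f` in `R₁` is the total transform
(`content_quadraticTransform_origin`) `C(f) R₁ = (x ^ (N i₀ + N j + r) · t ^ (N j)) · J₀'` with
`J₀'` the localised weak transform of `J₀`, `r = ord J₀`, and `λ(R₁/J₀') < λ(R/J₀)`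
(`length_quotient_weakTransform_map_lt_of_not_le`). Then:

* if `t ∈ 𝔪_{R₁}` (the next centre is the ORIGIN of the chart): `Q = (x, t)`
  (`eq_span_pair_of_mem_cornerStepState`: every `a ∈ A` is `c + t g` with `c ∈ R`, and
  `c ∈ Q ∩ R ⊆ 𝔪_R = (x, xt)`), so `𝔪_{R₁} = (x, t)` and `(u', N₁, J₀')` is a CORNER
  state;
* if `t` is a unit of `R₁` (a FREE point): `𝔪_{R₁} = (x, w)` for some `w`
  (`exists_eq_span_pair_of_map_maximalIdeal_le`), the logarithmic condition along `t` is void, and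
  `(x ^ n · t ^ m) = (x ^ n)`, so `((x, w), n, J₀')` is a FREE state with boundary `{x}`.

References: J. Giraud, *Forme normale d'une fonction sur une surface de caractéristique
positive*, Bull. SMF 111 (1983), Lemme 2.3(i), §2.5.
-/

set_option linter.dupNamespace false

noncomputable section

open IsLocalRing Literature.AlgebraicGeometry.Resolution

namespace Summit.ResolutionOfSingularities.ResolutionOfSingularities.Theorems.PfaffLine

section CornerStepState

/-- A product over `Fin 2` read off from any index `i₀`: `∏ F = F i₀ * F (i₀ + 1)`.
[folklore] -/
theorem prod_univ_fin_two_cornerStepState {M : Type*} [CommMonoid M] (i₀ : Fin 2)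
    (F : Fin 2 → M) : (Finset.univ.prod fun i => F i) = F i₀ * F (i₀ + 1) := by
  rcases fin_two_eq_or_eq_add_one_cornerStep 0 i₀ with rfl | rfl
  · rw [Fin.prod_univ_two]; rfl
  · rw [Fin.prod_univ_two, mul_comm]; rfl

/-- The range of a family indexed by `Fin 2`, read off from any index `i₀`. [folklore] -/
theorem range_eq_pair_cornerStepState {α : Type*} (v : Fin 2 → α) (i₀ : Fin 2) :
    Set.range v = {v i₀, v (i₀ + 1)} := by
  ext z
  simp only [Set.mem_range, Set.mem_insert_iff, Set.mem_singleton_iff]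
  constructor
  · rintro ⟨j, rfl⟩
    rcases fin_two_eq_or_eq_add_one_cornerStep i₀ j with rfl | rfl
    · exact Or.inl rfl
    · exact Or.inr rfl
  · rintro (rfl | rfl)
    exacts [⟨i₀, rfl⟩, ⟨i₀ + 1, rfl⟩]

variable {K : Type} [Field K]

open Polynomial in
/-- **The origin of the chart.** In the chart `A = R[t]`, `t = y/x`, of a local ring
`(R, 𝔪 = (x, y))` (`x ≠ 0`): a proper ideal `Q` of `A` containing `x` and `t` IS `(x, t)`.
Indeed every `a ∈ A` is `a = t · g + c` with `g ∈ A`, `c ∈ R` (`a = F(t)`,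
`F = X · divX F + C (F 0)`); if `a ∈ Q` then `c ∈ Q ∩ R`, a proper ideal of `R`, so
`c ∈ 𝔪_R` and `c ∈ 𝔪_R A = x A`. [folklore] -/
theorem eq_span_pair_of_mem_cornerStepState {R : Subring K} [IsLocalRing R] {x y : R}
    (hm : maximalIdeal R = Ideal.span {x, y}) (hx0 : x ≠ 0)
    {Q : Ideal (chartAdjoin (K := K) x y)} (hQ : Q ≠ ⊤) (hxQ : chartIncl x y x ∈ Q)
    (htQ : (⟨((y : R) : K) / ((x : R) : K), Algebra.self_mem_adjoin_singleton R _⟩ :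
      chartAdjoin (K := K) x y) ∈ Q) :
    Q = Ideal.span {chartIncl x y x,
      ⟨((y : R) : K) / ((x : R) : K), Algebra.self_mem_adjoin_singleton R _⟩} := by
  set t : chartAdjoin (K := K) x y :=
    ⟨((y : R) : K) / ((x : R) : K), Algebra.self_mem_adjoin_singleton R _⟩ with ht
  apply le_antisymm
  · intro a ha
    obtain ⟨F, hF⟩ := exists_aeval_eq_of_mem_adjoin a.2
    set g : chartAdjoin (K := K) x y :=
      ⟨aeval (((y : R) : K) / ((x : R) : K)) F.divX, Polynomial.aeval_mem_adjoin_singleton R _⟩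
      with hg
    have hdec : a = t * g + chartIncl x y (F.coeff 0) := Subtype.ext (by
      change (a : K) = ((y : R) : K) / ((x : R) : K) * aeval (((y : R) : K) / ((x : R) : K)) F.divX
        + ((F.coeff 0 : R) : K)
      rw [← hF]
      conv_lhs => rw [← Polynomial.X_mul_divX_add F]
      rw [map_add, map_mul, aeval_X, aeval_C]
      rfl)
    have hc : chartIncl x y (F.coeff 0) ∈ Q := by
      have e : chartIncl x y (F.coeff 0) = a - t * g := by rw [hdec]; ring
      rw [e]
      exact Q.sub_mem ha (Q.mul_mem_right _ htQ)
    have hcm : F.coeff 0 ∈ maximalIdeal R :=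
      IsLocalRing.le_maximalIdeal (Ideal.comap_ne_top _ hQ) (Ideal.mem_comap.mpr hc)
    have hcx : chartIncl x y (F.coeff 0) ∈ Ideal.span {chartIncl (K := K) x y x} := by
      rw [← map_maximalIdeal_chartIncl hm hx0]
      exact Ideal.mem_map_of_mem _ hcm
    rw [hdec, Ideal.span_insert]
    exact Submodule.mem_sup.mpr ⟨chartIncl x y (F.coeff 0), hcx, t * g,
      Ideal.mul_mem_right _ _ (Ideal.mem_span_singleton_self t), add_comm _ _⟩
  · rw [Ideal.span_le]
    rintro _ (rfl | rfl)
    exacts [hxQ, htQ]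

end CornerStepState

open IsLocalRing

/-- **Registered stub `giraud_corner_step_state`** (CS-conv: the corner step of Giraud's
induction, Giraud 1983 Lemme 2.3(i), with its output re-packaged as the induction state at the
quadratic transform). At a CORNER `u = (u 0, u 1)` of the two-dimensional regular local ring
`R ⊆ K` dominated by `O` with log-content `C(f) = (u ^ N) · J₀` (`J₀ ≠ R` of finite colength):
with `x = u i₀` of minimal value and `t = u_j / x`, `R₁ = R[t]_{𝔪_O ∩ R[t]}` and in the
chart coordinates `u' = (x, t)` the log-content of `f` in `R₁` is
`(x ^ (N i₀ + N j + r) · t ^ (N j)) · J₀'` with `λ(R₁/J₀') < λ(R/J₀)`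
(`content_quadraticTransform_origin`, `map_eq_span_pow_mul_weakTransform`,
`length_quotient_weakTransform_map_lt_of_not_le`). If `t ∈ 𝔪_{R₁}` then `𝔪_{R₁} = (x, t)`
(`eq_span_pair_of_mem_cornerStepState`) and this is a CORNER state; if `t` is a unit then
`𝔪_{R₁} = (x, w)` (`exists_eq_span_pair_of_map_maximalIdeal_le`), the logarithmic condition
along `t` is void and `(x ^ n t ^ m) = (x ^ n)`: a FREE state with boundary `{x}`. [folklore] -/
theorem giraud_corner_step_state : ∀ {K : Type} [Field K] (O : ValuationSubring K) (R R₁ : Subring K) [IsRegularLocalRing R] [IsLocalRing R₁] (h : Literature.AlgebraicGeometry.Resolution.IsQuadraticTransformAlong O R R₁), ringKrullDim R = 2 → Literature.AlgebraicGeometry.Resolution.SubringDominates R O.toSubring → (∀ (N : Type) [CommRing N] (ψ : R →+* N) (δ₀ : R →+ N), (∀ a b, δ₀ (a * b) = ψ a * δ₀ b + ψ b * δ₀ a) → ∀ Y : Finset R, ∃ (m : ℕ) (Δ : Fin m → Derivation ℤ R R) (nn : Fin m → N), ∀ y ∈ Y, δ₀ y = Finset.univ.sum fun j => ψ (Δ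 j y) * nn j) → (∀ (v : Fin 2 → R), Ideal.span (Set.range v) = maximalIdeal R → ∃ D : Fin 2 → Derivation ℤ R R, ∀ i j, D i (v j) = if i = j then 1 else 0) → ∀ (u : Fin 2 → R), Ideal.span (Set.range u) = maximalIdeal R → ∀ (f : R) (N : Fin 2 → ℕ) (J₀ : Ideal R), Ideal.span {b | ∃ δ : Derivation ℤ R R, (∀ i ∈ (Finset.univ : Finset (Fin 2)), δ (u i) ∈ Ideal.span {u i}) ∧ δ f = b} = Ideal.span {Finset.univ.prod fun i => u i ^ N i} * J₀ → IsFiniteLength R (R ⧸ J₀) → J₀ ≠ ⊤ → ringKrullDim R₁ ≤ 1 ∨ (∃ (u₁ : Fin 2 → R₁) (N₁ : Fin 2 → ℕ) (J₀' : Ideal R₁), Ideal.span (Set.range u₁) = maximalIdeal R₁ ∧ Ideal.span {b | ∃ δ' : Derivation ℤ R₁ R₁, (∀ i ∈ (Finset.univ : Finset (Fin 2)), δ' (u₁ i) ∈ Ideal.span {u₁ i}) ∧ δ' (Subring.inclusion h.le f) = b} = Ideal.span {Finset.univ.prod fun i => u₁ i ^ N₁ i} * J₀' ∧ IsFiniteLength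 R₁ (R₁ ⧸ J₀') ∧ Module.length R₁ (R₁ ⧸ J₀') < Module.length R (R ⧸ J₀)) ∨ (∃ (u₁ : Fin 2 → R₁) (a₁ : ℕ) (D₀' : Ideal R₁), Ideal.span (Set.range u₁) = maximalIdeal R₁ ∧ Ideal.span {b | ∃ δ' : Derivation ℤ R₁ R₁, (∀ i ∈ ({0} : Finset (Fin 2)), δ' (u₁ i) ∈ Ideal.span {u₁ i}) ∧ δ' (Subring.inclusion h.le f) = b} = Ideal.span {u₁ 0 ^ a₁} * D₀' ∧ IsFiniteLength R₁ (R₁ ⧸ D₀') ∧ Module.length R₁ (R₁ ⧸ D₀') < Module.length R (R ⧸ J₀)) := by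
  intro K _ O R R₁ _ _ h hdim hdom hrich hdual u hspan f N J₀ hJ hfin hJtop
  classical
  have hum : ∀ j, u j ∈ maximalIdeal R := fun j =>
    hspan ▸ Ideal.subset_span (Set.mem_range_self j)
  have hRO : R ≤ O.toSubring := hdom.1
  -- STEP 1: the parameter `x = u i₀` of minimal value (`𝔪 ≠ 0`)
  have hne : ∃ i ∈ (Finset.univ : Finset (Fin 2)), ((u i : R) : K) ≠ 0 := by
    by_contra hcon
    apply maximalIdeal_ne_span_singleton hdim (0 : R)
    rw [Ideal.span_singleton_zero, ← hspan, Ideal.span_eq_bot]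
    rintro _ ⟨j, rfl⟩
    by_contra hj
    exact hcon ⟨j, Finset.mem_univ j, fun h0 => hj (Subtype.ext h0)⟩
  obtain ⟨i₀, -, hx0K', hmax⟩ :=
    exists_max_valuation O Finset.univ (fun j => ((u j : R) : K)) hne
  have hx0K : ((u i₀ : R) : K) ≠ 0 := hx0K'
  have hx0 : u i₀ ≠ 0 := fun e => hx0K (by rw [e]; rfl)
  have hmin : ∀ z ∈ maximalIdeal R, O.valuation (z : K) ≤ O.valuation ((u i₀ : R) : K) := by
    intro z hz
    rw [← hspan] at hz
    induction hz using Submodule.span_induction with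
    | mem z hz =>
      obtain ⟨j, rfl⟩ := hz
      exact hmax j (Finset.mem_univ j)
    | zero => simp
    | add a b _ _ ha hb =>
      rw [Subring.coe_add]
      exact (Valuation.map_add _ _ _).trans (max_le ha hb)
    | smul a b _ hb =>
      rw [smul_eq_mul, Subring.coe_mul, map_mul]
      calc O.valuation (a : K) * O.valuation (b : K) ≤ 1 * O.valuation ((u i₀ : R) : K) :=
            mul_le_mul' ((O.valuation_le_one_iff _).mpr (hRO a.2)) hb
        _ = O.valuation ((u i₀ : R) : K) := one_mul _
  have hi₀1 : i₀ + 1 ≠ i₀ := by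
    rcases fin_two_eq_or_eq_add_one_cornerStep 0 i₀ with rfl | rfl <;> decide
  have hm : maximalIdeal R = Ideal.span {u i₀, u (i₀ + 1)} := by
    rw [← hspan, range_eq_pair_cornerStepState u i₀]
  -- STEP 2: the chart `A = R[y/x] ⊆ O` and `R₁ = A_{𝔪_O ∩ A}`
  have hyxO : ((u (i₀ + 1) : R) : K) / ((u i₀ : R) : K) ∈ O.toSubring := by
    change ((u (i₀ + 1) : R) : K) / ((u i₀ : R) : K) ∈ O
    rw [← O.valuation_le_one_iff, map_div₀,
      div_le_one₀ (pos_iff_ne_zero.mpr ((map_ne_zero _).mpr hx0K))]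
    exact hmin _ (hum _)
  have hAO : chartAdjoin (K := K) (u i₀) (u (i₀ + 1)) ≤ O.toSubring :=
    adjoin_toSubring_le hRO hyxO
  have hA : blowupRing R ((u i₀ : R) : K) = chartAdjoin (K := K) (u i₀) (u (i₀ + 1)) :=
    blowupRing_eq_adjoin hm
  have hR₁T : R₁ = (LocalSubring.ofPrime (chartAdjoin (K := K) (u i₀) (u (i₀ + 1)))
      (subringCentre (chartAdjoin (K := K) (u i₀) (u (i₀ + 1))) O hAO)).toSubring := by
    rw [eq_locAtCentre_blowupRing_cornerStep O R R₁ h hRO u hspan i₀ hx0 hmin, hA]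
    exact locAtCentre_eq_ofPrime hAO
  subst hR₁T
  set A : Subring K := chartAdjoin (K := K) (u i₀) (u (i₀ + 1)) with hAdef
  set Q : Ideal A := subringCentre A O hAO with hQdef
  set T : Subring K := (LocalSubring.ofPrime A Q).toSubring with hTdef
  have hAT : A ≤ T := LocalSubring.le_ofPrime A Q
  -- the order `r ≥ 1` of `J₀`
  obtain ⟨r, hr1, hJr, hJr1⟩ :=
    exists_order_cornerStep hJtop (ne_bot_of_isFiniteLength_quotient_cornerStep hdim hfin)
  -- the origin chart coordinates `u' i₀ = x`, `u' j = u_j / x`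
  have hxT : ((u i₀ : R) : K) ∈ T := h.le (u i₀).2
  have hdivT : ∀ j, ((u j : R) : K) / ((u i₀ : R) : K) ∈ T := fun j =>
    hAT (hA ▸ div_mem_blowupRing ((u i₀ : R) : K) (hum j))
  have htA : ((u (i₀ + 1) : R) : K) / ((u i₀ : R) : K) ∈ A :=
    Algebra.self_mem_adjoin_singleton R _
  set u' : Fin 2 → T := fun j =>
    if j = i₀ then ⟨((u i₀ : R) : K), hxT⟩
    else ⟨((u j : R) : K) / ((u i₀ : R) : K), hdivT j⟩
    with hu'
  have hi₀' : ((u' i₀ : T) : K) = ((u i₀ : R) : K) := by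
    simp [hu']
  have hj' : ∀ j, j ≠ i₀ → ((u' j : T) : K) = ((u j : R) : K) / ((u i₀ : R) : K) := by
    intro j hj
    simp [hu', hj]
  have h0' : Subring.inclusion h.le (u i₀) = u' i₀ := Subtype.ext hi₀'.symm
  have hxT' : algebraMap A T (chartIncl (u i₀) (u (i₀ + 1)) (u i₀)) = u' i₀ :=
    Subtype.ext (by rw [hi₀']; rfl)
  have htT' : algebraMap A T ⟨_, htA⟩ = u' (i₀ + 1) :=
    Subtype.ext (by rw [hj' _ hi₀1]; rfl)
  have hyT : Subring.inclusion h.le (u (i₀ + 1)) = u' (i₀ + 1) * u' i₀ := Subtype.ext (by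
    rw [Subring.coe_mul, hj' (i₀ + 1) hi₀1, hi₀', Subring.coe_inclusion]
    exact (div_mul_cancel₀ _ hx0K).symm)
  -- STEP 3: the content is the total transform `(u ^ N) · xʳ · J₀'`,
  -- with `λ(T/J₀') < λ(R/J₀)`
  obtain ⟨D, hD⟩ := hdual u hspan
  have hC := content_quadraticTransform_origin O R T h hrich u D hD hspan i₀ hx0K u' hi₀' hj' f
  have hcomp : Subring.inclusion h.le =
      (algebraMap A T).comp (chartIncl (K := K) (u i₀) (u (i₀ + 1))) :=
    RingHom.ext fun _ => Subtype.ext rfl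
  have hJ₀map : J₀.map (Subring.inclusion h.le) =
      Ideal.span {algebraMap A T (chartIncl (u i₀) (u (i₀ + 1)) (u i₀)) ^ r} *
        (weakTransformChart (u i₀) (u (i₀ + 1)) J₀ r).map (algebraMap A T) := by
    rw [hcomp, ← Ideal.map_map, map_eq_span_pow_mul_weakTransform hm hx0 hJr, Ideal.map_mul,
      Ideal.map_span, Set.image_singleton, map_pow]
  have hlt := length_quotient_weakTransform_map_lt_of_not_le (K := K) hdim hm hx0 hr1 hJr hJr1
    hfin Q
  set J₀' : Ideal T := (weakTransformChart (u i₀) (u (i₀ + 1)) J₀ r).map (algebraMap A T)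
    with hJ₀'def
  have hfin' : IsFiniteLength T (T ⧸ J₀') := Module.length_ne_top_iff.mp (ne_top_of_lt hlt)
  have hmono : Subring.inclusion h.le (Finset.univ.prod fun i => u i ^ N i) *
      algebraMap A T (chartIncl (u i₀) (u (i₀ + 1)) (u i₀)) ^ r =
      u' i₀ ^ (N i₀ + N (i₀ + 1) + r) * u' (i₀ + 1) ^ N (i₀ + 1) := by
    rw [map_prod, prod_univ_fin_two_cornerStepState i₀, map_pow, map_pow, h0', hyT, hxT']
    ring
  have hCm : Ideal.span {b | ∃ δ' : Derivation ℤ T T,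
      (∀ j ∈ (Finset.univ : Finset (Fin 2)), δ' (u' j) ∈ Ideal.span {u' j}) ∧
        δ' (Subring.inclusion h.le f) = b} =
      Ideal.span {u' i₀ ^ (N i₀ + N (i₀ + 1) + r) * u' (i₀ + 1) ^ N (i₀ + 1)} *
        J₀' := by
    rw [hC, hJ, Ideal.map_mul, hJ₀map, Ideal.map_span, Set.image_singleton, ← mul_assoc,
      Ideal.span_singleton_mul_span_singleton, hmono]
  -- the exceptional prime lies in the centre: `𝔪_R A ≤ Q`
  have h𝔭Q : (maximalIdeal R).map (chartIncl (K := K) (u i₀) (u (i₀ + 1))) ≤ Q := by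
    rw [Ideal.map_le_iff_le_comap]
    intro z hz
    rw [Ideal.mem_comap, hQdef, mem_subringCentre_iff]
    exact ((subringDominates_valuationSubring_iff hRO).mp hdom z).mp hz
  have hxQ : chartIncl (K := K) (u i₀) (u (i₀ + 1)) (u i₀) ∈ Q :=
    h𝔭Q (Ideal.mem_map_of_mem _ (hum i₀))
  -- STEP 4: dichotomy on `t = u' j`
  right
  by_cases ht : u' (i₀ + 1) ∈ maximalIdeal T
  · -- (a) the ORIGIN: `𝔪_T = (x, t)`, corner state
    left
    have htQ : (⟨_, htA⟩ : A) ∈ Q := by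
      rw [← IsLocalization.AtPrime.to_map_mem_maximal_iff T Q, htT']
      exact ht
    have hQeq := eq_span_pair_of_mem_cornerStepState hm hx0
      (Ideal.IsPrime.ne_top inferInstance) hxQ htQ
    have e : Q.map (algebraMap A T) =
        (Ideal.span {chartIncl (K := K) (u i₀) (u (i₀ + 1)) (u i₀), ⟨_, htA⟩}).map
          (algebraMap A T) := congrArg (Ideal.map (algebraMap A T)) hQeq
    have hmax : maximalIdeal T = Ideal.span (Set.range u') := by
      rw [← IsLocalization.AtPrime.map_eq_maximalIdeal Q T, e, Ideal.map_span,
        Set.image_insert_eq, Set.image_singleton, hxT', htT', range_eq_pair_cornerStepState u' i₀]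
    obtain ⟨N₁, hN₁⟩ : ∃ N₁ : Fin 2 → ℕ, (Finset.univ.prod fun i => u' i ^ N₁ i) =
        u' i₀ ^ (N i₀ + N (i₀ + 1) + r) * u' (i₀ + 1) ^ N (i₀ + 1) :=
      ⟨fun i => if i = i₀ then N i₀ + N (i₀ + 1) + r else N (i₀ + 1), by
        rw [prod_univ_fin_two_cornerStepState i₀]
        beta_reduce
        rw [if_pos rfl, if_neg hi₀1]⟩
    refine ⟨u', N₁, J₀', hmax.symm, ?_, hfin', hlt⟩
    rw [hN₁]
    exact hCm
  · -- (b) a FREE point: `t` is a unit, `𝔪_T = (x, w)`, free state with boundary `{x}`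
    right
    have htu : IsUnit (u' (i₀ + 1)) := IsLocalRing.notMem_maximalIdeal.mp ht
    obtain ⟨fQ, hQf⟩ := exists_eq_span_pair_of_map_maximalIdeal_le hm hx0 rfl h𝔭Q
    have e : Q.map (algebraMap A T) =
        (Ideal.span {chartIncl (K := K) (u i₀) (u (i₀ + 1)) (u i₀), fQ}).map
          (algebraMap A T) := congrArg (Ideal.map (algebraMap A T)) hQf
    have hmax : maximalIdeal T = Ideal.span {u' i₀, algebraMap A T fQ} := by
      rw [← IsLocalization.AtPrime.map_eq_maximalIdeal Q T, e, Ideal.map_span,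
        Set.image_insert_eq, Set.image_singleton, hxT']
    have hset : {b | ∃ δ' : Derivation ℤ T T,
        (∀ i ∈ ({0} : Finset (Fin 2)), δ' (![u' i₀, algebraMap A T fQ] i) ∈
          Ideal.span {![u' i₀, algebraMap A T fQ] i}) ∧ δ' (Subring.inclusion h.le f) = b} =
        {b | ∃ δ' : Derivation ℤ T T,
          (∀ j ∈ (Finset.univ : Finset (Fin 2)), δ' (u' j) ∈ Ideal.span {u' j}) ∧
            δ' (Subring.inclusion h.le f) = b} := by
      ext b
      refine exists_congr fun δ' => and_congr_left fun _ => ?_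
      simp only [Finset.mem_singleton, forall_eq, Matrix.cons_val_zero, Finset.mem_univ,
        forall_const]
      constructor
      · intro h0 j
        rcases fin_two_eq_or_eq_add_one_cornerStep i₀ j with rfl | rfl
        · exact h0
        · rw [Ideal.span_singleton_eq_top.mpr htu]
          exact Submodule.mem_top
      · intro hall
        exact hall i₀
    have key : Ideal.span {b | ∃ δ' : Derivation ℤ T T,
        (∀ i ∈ ({0} : Finset (Fin 2)), δ' (![u' i₀, algebraMap A T fQ] i) ∈
          Ideal.span {![u' i₀, algebraMap A T fQ] i}) ∧ δ' (Subring.inclusion h.le f) = b} =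
        Ideal.span {![u' i₀, algebraMap A T fQ] 0 ^ (N i₀ + N (i₀ + 1) + r)} * J₀' := by
      rw [hset, hCm, Matrix.cons_val_zero, Ideal.span_singleton_mul_right_unit (htu.pow _)]
    refine ⟨![u' i₀, algebraMap A T fQ], N i₀ + N (i₀ + 1) + r, J₀', ?_, key, hfin',
      hlt⟩
    rw [Matrix.range_cons_cons_empty, hmax]

end Summit.ResolutionOfSingularities.ResolutionOfSingularities.Theorems.PfaffLine

end
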